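import Literature.NumberTheory.Sieve.LiouvillePolynomialValuesWeylTopCoeff
import Literature.NumberTheory.Sieve.VinogradovExpSumTools
import Literature.NumberTheory.CubicFields.BinaryCubicForms

/-!
# `DigitRung` (stmt-QuantumAdvantage-15008), line `Sketch` — stub `stub_fibreWeyl`: the `c`-fibre Weyl bound at dyadic frequencies

First lemma of the open input `stub_torsWeyl` (the middle band), along the line chosen by both
triagers (idea cards `circle-uniform-fibre-weyl` ≈ `fibred-weyl-middle-coefficient`): after the
Davenport–Heilbronn / Bhargava–Shankar–Tsimerman reduction, the `3`-torsion-weighted Weyl sum at the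
frequency `r/2^k` is a sum of `e(r·Disc(f)/2^k)` over integral binary cubic forms `f = (a,b,c,d)` in
a fundamental region, and along each **`c`-fibre** the phase is a real CUBIC polynomial in `c` with
leading coefficient `−4a·r/2^k = ∓a'r/2^{k−2−v₂(a)}` (`a = 2^{v₂(a)} a'`), an ODD numerator over a power
of two. This file proves the fibre estimate, uniformly in the odd frequency `r` ("dyadic frequencies
are never major"):

* `StubFibreWeyl.norm_sum_e_lt_of_dyadic_coeff` — for a real polynomial of degree `≤ 3` whose
  `X³`-coefficient is `u/2^m` with `u` odd: `‖Σ_{c₀ < n ≤ c₀+L} e(p(n))‖ < δ L` as soon as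
  `K < 2^m` and `2^m K < L³`, where `K = C (8/δ²)^A` is the constant of the tree's (proved) Weyl
  estimate in inverse form `Teravainen2024.weyl_topCoeff` (Green–Tao 2012, Lemma 4.4): a large sum
  forces `‖k · u/2^m‖ ≤ K/L³` for some `1 ≤ k ≤ K < 2^m`, but `2^m ∤ k u`, so `‖k u/2^m‖ ≥ 2^{−m} > K/L³`;
* `stub_fibreWeyl` — the same for the `c`-fibre of the discriminant,
  `p = (r/2^k)·Disc(2^v a', b, ·, d)` (written with Mathlib's `Cubic.toPoly`, no new definition), `a'`, `r` odd, `v + 2 ≤ k`: window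
  `K < 2^{k−2−v} < L³/K`.
In the application `L = L_c ≍ X^{1/4} t` (Bhargava's box at height `t`), `δ = L^{−η}`, and the window
holds for every `X^{O(η)} < 2^k < X^{3/4−O(η)} t³` and every typical `a` (`2^{v₂(a)} ≤ X^{O(η)}`), which
covers the band `K₀ ≤ k ≤ 7n/10 + 1` consumed by `stub_composition`. Everything here is proved.
-/

noncomputable section

namespace Summit.QuantumAdvantage.DigitRung.Sketch

open scoped Classical FourierTransform
open Finset Polynomial
open Literature.NumberTheory.Sieve.Vinogradov
open Literature.NumberTheory.CubicFields

namespace StubFibreWeyl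

/-- The tree's `VdC.e` is Mathlib's additive character `𝐞`, coerced to `ℂ`. [folklore] -/
theorem fourierChar_coe_eq_e (x : ℝ) :
    (𝐞 x : ℂ) = Literature.NumberTheory.LFunctions.VdC.e x := rfl

/-- Dyadic spacing: if `2^m ∤ v` then `2^m · ‖v/2^m‖ ≥ 1`. [folklore] -/
theorem one_le_two_pow_mul_distInt_of_not_dvd {v : ℤ} {m : ℕ} (hv : ¬ (2 : ℤ) ^ m ∣ v) :
    1 ≤ (2 : ℝ) ^ m * distInt ((v : ℝ) / 2 ^ m) := by
  unfold distInt
  set R : ℤ := round ((v : ℝ) / 2 ^ m) with hR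
  have h2 : (0 : ℝ) < 2 ^ m := by positivity
  have hkey : (v : ℝ) / 2 ^ m - R = (((v - R * 2 ^ m : ℤ)) : ℝ) / (2 : ℝ) ^ m := by
    push_cast
    field_simp
  have hne : (v - R * 2 ^ m : ℤ) ≠ 0 := by
    intro h0
    exact hv ⟨R, by linarith⟩
  have h1 : (1 : ℝ) ≤ |(((v - R * 2 ^ m : ℤ)) : ℝ)| := by exact_mod_cast Int.one_le_abs hne
  rw [hkey, abs_div, abs_of_pos h2]
  calc (1 : ℝ) ≤ |(((v - R * 2 ^ m : ℤ)) : ℝ)| := h1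
    _ = (2 : ℝ) ^ m * (|(((v - R * 2 ^ m : ℤ)) : ℝ)| / 2 ^ m) := by field_simp

/-- An odd multiple of `k`, `1 ≤ k < 2^m`, is not divisible by `2^m`. [folklore] -/
theorem not_two_pow_dvd_mul {u : ℤ} (hu : Odd u) {k m : ℕ} (hk1 : 1 ≤ k) (hk : (k : ℤ) < 2 ^ m) :
    ¬ (2 : ℤ) ^ m ∣ (k : ℤ) * u := by
  intro h
  obtain ⟨w, rfl⟩ := hu
  have hcop : IsCoprime ((2 : ℤ) ^ m) (2 * w + 1) := by
    apply IsCoprime.pow_left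
    exact ⟨-w, 1, by ring⟩
  have hdvd : (2 : ℤ) ^ m ∣ (k : ℤ) := hcop.dvd_of_dvd_mul_right h
  have hle := Int.le_of_dvd (by exact_mod_cast hk1) hdvd
  omega

/-- **The fibre estimate at a dyadic leading coefficient.** There are `A : ℕ`, `C ≥ 1` (those of
`Teravainen2024.weyl_topCoeff 3`) such that for every real polynomial `p` of degree `≤ 3` with
`X³`-coefficient `u/2^m`, `u` odd, every `0 < δ ≤ 1` and every interval of `L ≥ 1` integers: if
`K := C(8/δ²)^A < 2^m` and `2^m K < L³` then `‖Σ_{c₀ < n ≤ c₀ + L} e(p(n))‖ < δ L`. [folklore] -/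
theorem norm_sum_e_lt_of_dyadic_coeff :
    ∃ (A : ℕ) (C : ℝ), 1 ≤ C ∧
      ∀ (δ : ℝ) (c₀ : ℤ) (L : ℕ) (p : ℝ[X]) (u : ℤ) (m : ℕ),
        0 < δ → δ ≤ 1 → p.natDegree ≤ 3 → 1 ≤ L → Odd u → p.coeff 3 = (u : ℝ) / 2 ^ m →
        C * (8 / δ ^ 2) ^ A < (2 : ℝ) ^ m →
        (2 : ℝ) ^ m * (C * (8 / δ ^ 2) ^ A) < (L : ℝ) ^ 3 →
        ‖∑ n ∈ Finset.Ioc c₀ (c₀ + L), (𝐞 (p.eval (n : ℝ)) : ℂ)‖ < δ * L := by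
  obtain ⟨A, C, hC, hW⟩ := Literature.NumberTheory.Sieve.Teravainen2024.weyl_topCoeff 3 (by norm_num)
  refine ⟨A, C, hC, ?_⟩
  intro δ c₀ L p u m hδ hδ1 hp hL hu hcoeff hK1 hK2
  set K : ℝ := C * (8 / δ ^ 2) ^ A with hKdef
  by_contra hge
  push Not at hge
  simp_rw [fourierChar_coe_eq_e] at hge
  obtain ⟨k, hk1, hkK, hdist⟩ := hW δ c₀ L p hδ hδ1 hp hL hge
  -- `k < 2^m`, so `2^m ∤ k u` and `‖k u / 2^m‖ ≥ 2^{-m}`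
  have hk2m : (k : ℝ) < (2 : ℝ) ^ m := hkK.trans_lt hK1
  have hk2mZ : (k : ℤ) < 2 ^ m := by exact_mod_cast hk2m
  have hnd := not_two_pow_dvd_mul hu hk1 hk2mZ
  have hlow := one_le_two_pow_mul_distInt_of_not_dvd hnd
  have heq : ((((k : ℤ) * u : ℤ)) : ℝ) / 2 ^ m = (k : ℝ) * p.coeff 3 := by
    rw [hcoeff]; push_cast; ring
  rw [heq] at hlow
  -- compare with the Weyl conclusion `‖k p₃‖ ≤ K / L³`
  have hLpos : (0 : ℝ) < (L : ℝ) ^ 3 := by positivity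
  have h2m : (0 : ℝ) < (2 : ℝ) ^ m := by positivity
  have h1 : (1 : ℝ) ≤ (2 : ℝ) ^ m * (K / (L : ℝ) ^ 3) :=
    hlow.trans (mul_le_mul_of_nonneg_left hdist h2m.le)
  rw [← mul_div_assoc, one_le_div hLpos] at h1
  linarith

/-! ### The `c`-fibre of the discriminant -/

/-- The `c`-fibre phase polynomial `X ↦ α · Disc(a, b, X, d)` is
`C α · (−4a X³ + b² X² + 18abd X − 4b³d − 27a²d²)`; written with Mathlib's `Cubic.toPoly` (no new
definition). Its `X³`-coefficient is `−4aα`. [folklore] -/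
theorem coeff_fibre_three (α : ℝ) (a b d : ℤ) :
    (Polynomial.C α * Cubic.toPoly ⟨-(4 * (a : ℝ)), (b : ℝ) ^ 2, 18 * (a : ℝ) * b * d,
        -(4 * (b : ℝ) ^ 3 * d) - 27 * (a : ℝ) ^ 2 * (d : ℝ) ^ 2⟩).coeff 3 = α * (-(4 * (a : ℝ))) := by
  rw [Polynomial.coeff_C_mul, Cubic.coeff_eq_a]

/-- The fibre polynomial has degree `≤ 3`. [folklore] -/
theorem natDegree_fibre_le (α : ℝ) (a b d : ℤ) :
    (Polynomial.C α * Cubic.toPoly ⟨-(4 * (a : ℝ)), (b : ℝ) ^ 2, 18 * (a : ℝ) * b * d,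
        -(4 * (b : ℝ) ^ 3 * d) - 27 * (a : ℝ) ^ 2 * (d : ℝ) ^ 2⟩).natDegree ≤ 3 :=
  (Polynomial.natDegree_C_mul_le _ _).trans Polynomial.natDegree_cubic_le

/-- The fibre polynomial evaluates at an integer `c` to `α · Disc(a, b, c, d)`. [folklore] -/
theorem eval_fibre (α : ℝ) (a b d c : ℤ) :
    (Polynomial.C α * Cubic.toPoly ⟨-(4 * (a : ℝ)), (b : ℝ) ^ 2, 18 * (a : ℝ) * b * d,
        -(4 * (b : ℝ) ^ 3 * d) - 27 * (a : ℝ) ^ 2 * (d : ℝ) ^ 2⟩).eval (c : ℝ) =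
      α * ((⟨a, b, c, d⟩ : BinaryCubic ℤ).disc : ℝ) := by
  simp only [Cubic.toPoly, Polynomial.eval_mul, Polynomial.eval_C, Polynomial.eval_add,
    Polynomial.eval_pow, Polynomial.eval_X, BinaryCubic.disc_eq]
  push_cast
  ring

/-- The dyadic shape of the leading coefficient: for `a = 2^v a'` and `v + 2 ≤ k`,
`(r/2^k)·(−4a) = (−a'r)/2^{k−2−v}`. [folklore] -/
theorem coeff_dyadic (a' : ℤ) (v k r : ℕ) (hk : v + 2 ≤ k) :
    ((r : ℝ) / 2 ^ k) * (-(4 * ((2 ^ v * a' : ℤ) : ℝ))) = ((-(a' * r) : ℤ) : ℝ) / 2 ^ (k - 2 - v) := by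
  obtain ⟨m, rfl⟩ : ∃ m, k = m + 2 + v := ⟨k - 2 - v, by omega⟩
  rw [show m + 2 + v - 2 - v = m by omega, pow_add, pow_add]
  push_cast
  field_simp
  ring

end StubFibreWeyl

open StubFibreWeyl in
/-- **Stub (the `c`-fibre Weyl bound at dyadic frequencies).** There are `A : ℕ`, `C ≥ 1` such
that for every odd `a'`, `r`, every `b d : ℤ`, `v + 2 ≤ k`, `0 < δ ≤ 1` and every `c`-interval of
`L ≥ 1` integers, with `K = C(8/δ²)^A`: if `K < 2^{k−2−v}` and `2^{k−2−v} K < L³` then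
`‖Σ_{c₀ < c ≤ c₀+L} e(r · Disc(2^v a', b, c, d)/2^k)‖ < δ L`. The phase is a real cubic in `c` with
`X³`-coefficient `−a'r/2^{k−2−v}` (odd over a power of two), so the tree's Weyl estimate in inverse
form (`Teravainen2024.weyl_topCoeff`, Green–Tao 2012 Lemma 4.4) can only fail to give `δL` if
`‖k a'r/2^{k−2−v}‖ ≤ K/L³` for some `k ≤ K < 2^{k−2−v}` — impossible, such a `k a' r` is not divisible by
`2^{k−2−v}`. Uniform in the odd frequency `r` of any size: dyadic frequencies are never major.
[folklore] -/
theorem stub_fibreWeyl :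
    ∃ (A : ℕ) (C : ℝ), 1 ≤ C ∧
      ∀ (δ : ℝ) (c₀ : ℤ) (L : ℕ) (a' b d : ℤ) (v k r : ℕ), 0 < δ → δ ≤ 1 → 1 ≤ L → Odd a' →
        Odd r → v + 2 ≤ k →
        C * (8 / δ ^ 2) ^ A < (2 : ℝ) ^ (k - 2 - v) →
        (2 : ℝ) ^ (k - 2 - v) * (C * (8 / δ ^ 2) ^ A) < (L : ℝ) ^ 3 →
        ‖∑ c ∈ Finset.Ioc c₀ (c₀ + L),
            (𝐞 (((r : ℝ) / 2 ^ k) * (((⟨2 ^ v * a', b, c, d⟩ : BinaryCubic ℤ).disc : ℤ) : ℝ)) : ℂ)‖ <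
          δ * L := by
  obtain ⟨A, C, hC, h⟩ := norm_sum_e_lt_of_dyadic_coeff
  refine ⟨A, C, hC, ?_⟩
  intro δ c₀ L a' b d v k r hδ hδ1 hL ha' hr hk hK1 hK2
  have hu : Odd (-(a' * r) : ℤ) := (ha'.mul (by exact_mod_cast hr)).neg
  set p : ℝ[X] := Polynomial.C ((r : ℝ) / 2 ^ k) *
    Cubic.toPoly ⟨-(4 * (((2 ^ v * a' : ℤ)) : ℝ)), (b : ℝ) ^ 2, 18 * (((2 ^ v * a' : ℤ)) : ℝ) * b * d,
      -(4 * (b : ℝ) ^ 3 * d) - 27 * (((2 ^ v * a' : ℤ)) : ℝ) ^ 2 * (d : ℝ) ^ 2⟩ with hp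
  have hcoeff : p.coeff 3 = ((-(a' * r) : ℤ) : ℝ) / 2 ^ (k - 2 - v) := by
    rw [hp, coeff_fibre_three, coeff_dyadic a' v k r hk]
  have hmain := h δ c₀ L p (-(a' * r)) (k - 2 - v) hδ hδ1 (natDegree_fibre_le _ _ _ _) hL hu
    hcoeff hK1 hK2
  simpa only [hp, eval_fibre] using hmain

end Summit.QuantumAdvantage.DigitRung.Sketch

end
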